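import Summits.KontsevichZagierPeriods.KontsevichZagierPeriods.Theorems.UnfoldedStokesStokesGenerationFibrewiseRungScaling
import Summits.KontsevichZagierPeriods.KontsevichZagierPeriods.Theorems.UnfoldedStokesStokesGenerationFibrewiseClosureCongr

/-!
# `StokesGeneration` (stmt-KontsevichZagierPeriods-3586) — line `fibrewise_stokes`, stub `stub_landenPartThree`

Registered stub L1c (rung 18, Landen's identity, wave 2) of the line `fibrewise_stokes` of the crux `StokesGeneration`
(route UnfoldedStokes; residual S2 `FibStokesDecomposable`, `Theorems/UnfoldedStokesDefs.lean`). Rung 18 shows that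
LANDEN'S IDENTITY `Li₂(a) + Li₂(−a/(1−a)) + ½ log²(1−a) = 0` (`a` real algebraic, `a < 1`) is fibrewise-Stokes
decomposable via the homotopy `a ↦ au` in a third cube coordinate `u` (`s = x 0`, `t = x 1`, `u = x 2` on `[0,1]³`).
This file is the two-element certificate for the THIRD part `½ log²(1 − au) = ½ k(s,u) k(t,u)` integrated over
`(s,t)`, where `k(s,u) = −au/(1 − aus)` (so that `∫₀¹ k(s,u) ds = log(1 − au)`), `k_u = ∂_u k = −a/(1 − aus)²` and
`κ(s,u) = −as/(1 − aus)` (`∂_s κ = k_u`, `κ(0,u) = 0`, `κ(1,u) = −a/(1 − au)`):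
* `E_u`: primitive `G₀ = ½ k(x0,x2) k(x1,x2)` along the direction `2`, fibre derivative
  `D₀ = ½ (k_u(x0,x2) k(x1,x2) + k(x0,x2) k_u(x1,x2))`, faces `G₀|_{x2=1} − G₀|_{x2=0} = ½ k(x0,1) k(x1,1) − 0`;
* `E_s`: primitive `G₁ = −κ(x0,x2) k(x1,x2)` along the direction `0`, fibre derivative `D₁ = −k_u(x0,x2) k(x1,x2)`,
  faces `G₁|_{x0=1} − G₁|_{x0=0} = −κ(1,x2) k(x1,x2) − 0`.
The sum of the two element integrands `D_j − (faces)` is, pointwise on the cube, the registered integrand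
`½ (k k_u − k_u k) + κ(1,u) k(t,u) − ½ k(s,1) k(t,1)`. All denominators are `≥ min(1, 1 − a) > 0` on the closed cube.
The two elements are assembled by `fibStokesDecomposable_of_elements` (representations from `exists_cubeRep`) and the
pointwise identity is transferred by `fibStokesDecomposable_congr_off_null` with the empty null set — exactly the
pattern of the scaling certificate `fibStokesDecomposable_scalingCore`.

References: M. Kontsevich, D. Zagier, *Periods* (2001), §1.1 (polylogarithms as periods), §1.2 rule (3);
D. Zagier, *The dilogarithm function* (2007), §I.2 (Landen's identity).
-/

noncomputable section

-- `Summit.KontsevichZagierPeriods.KontsevichZagierPeriods.…` is the tree's mandated layout (single-conjunct summit).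
set_option linter.dupNamespace false

namespace Summit.KontsevichZagierPeriods.KontsevichZagierPeriods.Cruxes.StokesGeneration.FibrewiseStokes

open MeasureTheory Set
open Literature.NumberTheory.Transcendental
open Literature.NumberTheory.Transcendental.KZ
open Literature.ModelTheory.ExponentialFields (IsSemialgebraic)

/-- The one-variable derivative `∂_u (−au/(1 − auc)) = −a/(1 − auc)²` (the kernel `k(c,u)` of `log(1 − au)` in the
homotopy variable `u`). [folklore] -/
private theorem landenThree_hasDerivAt_k (a c u : ℝ) (h : 1 - a * u * c ≠ 0) :
    HasDerivAt (fun u => -(a * u) / (1 - a * u * c)) (-a / (1 - a * u * c) ^ 2) u := by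
  have h1 : HasDerivAt (fun u => -(a * u)) (-a) u := by
    simpa using (hasDerivAt_id' u).const_mul (-a)
  have h2 : HasDerivAt (fun u => 1 - a * u * c) (-(a * c)) u := by
    simpa using (((hasDerivAt_id' u).const_mul a).mul_const c).const_sub 1
  refine (h1.div h2 h).congr_deriv ?_
  field_simp
  ring

/-- The one-variable derivative `∂_s (−as/(1 − acs)) = −a/(1 − acs)²` (the primitive `κ(s,c)` of `k_u(s,c)` in the
cube variable `s`). [folklore] -/
private theorem landenThree_hasDerivAt_kappa (a c s : ℝ) (h : 1 - a * c * s ≠ 0) :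
    HasDerivAt (fun s => -(a * s) / (1 - a * c * s)) (-a / (1 - a * c * s) ^ 2) s := by
  have h1 : HasDerivAt (fun s => -(a * s)) (-a) s := by
    simpa using (hasDerivAt_id' s).const_mul (-a)
  have h2 : HasDerivAt (fun s => 1 - a * c * s) (-(a * c)) s := by
    simpa using ((hasDerivAt_id' s).const_mul (a * c)).const_sub 1
  refine (h1.div h2 h).congr_deriv ?_
  field_simp
  ring

/-- **Registered stub `stub_landenPartThree` (rung 18, L1c): the two-element certificate of the `½ log²(1 − au)` part
of Landen's identity.** With `k(s,u) = −au/(1 − aus)`, `k_u = −a/(1 − aus)²`, `κ(s,u) = −as/(1 − aus)`, the sum of the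
integrands of the elements `E_u[½ k(x0,x2) k(x1,x2)]` (direction `2`) and `E_s[−κ(x0,x2) k(x1,x2)]` (direction `0`),
namely `½ (k(x0,x2) k_u(x1,x2) − k_u(x0,x2) k(x1,x2)) + κ(1,x2) k(x1,x2) − ½ k(x0,1) k(x1,1)`, is fibrewise-Stokes
decomposable on `[0,1]³` for every real algebraic `a < 1`. [cite: KontsevichZagier2001, §1.2 rule (3)] -/
theorem stub_landenPartThree (a : ℝ) (ha : IsAlgebraic ℚ a) (ha1 : a < 1) :
    FibStokesDecomposable 3 (fun x =>
      (1 / 2) * ((-(a * x 2) / (1 - a * x 2 * x 0)) * (-a / (1 - a * x 2 * x 1) ^ 2) -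
          (-a / (1 - a * x 2 * x 0) ^ 2) * (-(a * x 2) / (1 - a * x 2 * x 1))) +
        (-a / (1 - a * x 2)) * (-(a * x 2) / (1 - a * x 2 * x 1)) -
        (1 / 2) * ((-a / (1 - a * x 0)) * (-a / (1 - a * x 1)))) := by
  classical
  set C : Set (Fin 3 → ℝ) := Set.pi Set.univ (fun _ : Fin 3 => Set.Icc (0:ℝ) 1) with hC
  have hCsa : IsSemialgebraic ℚ C := by rw [hC, ← cube_eq_pi]; exact isSemialgebraic_cube
  have hCc : IsCompact C := isCompact_univ_pi fun _ => isCompact_Icc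
  have hmem : ∀ x ∈ C, ∀ i, x i ∈ Set.Icc (0:ℝ) 1 := fun x hx i => (Set.mem_univ_pi.mp hx) i
  have hupd : ∀ x ∈ C, ∀ (i : Fin 3), ∀ s ∈ Set.Icc (0:ℝ) 1, Function.update x i s ∈ C :=
    fun x hx i s hs => update_mem_cubePi hx i hs
  have h02 : (0 : Fin 3) ≠ 2 := by decide
  have h12 : (1 : Fin 3) ≠ 2 := by decide
  have h10 : (1 : Fin 3) ≠ 0 := by decide
  have h20 : (2 : Fin 3) ≠ 0 := by decide
  -- positivity of the denominators on the closed cube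
  have hden : ∀ p : ℝ, 0 ≤ p → p ≤ 1 → 0 < 1 - a * p := by
    intro p hp0 hp1
    rcases le_or_gt 0 a with ha0 | ha0
    · have : a * p ≤ a := mul_le_of_le_one_right ha0 hp1
      linarith
    · nlinarith [mul_nonneg (neg_nonneg.mpr (le_of_lt ha0)) hp0]
  have hd1 : ∀ x ∈ C, ∀ i, 0 < 1 - a * x i := fun x hx i => hden _ (hmem x hx i).1 (hmem x hx i).2
  have hd2 : ∀ x ∈ C, ∀ i j, 0 < 1 - a * x i * x j := fun x hx i j => by
    rw [mul_assoc]
    exact hden _ (mul_nonneg (hmem x hx i).1 (hmem x hx j).1)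
      (mul_le_one₀ (hmem x hx i).2 (hmem x hx j).1 (hmem x hx j).2)
  -- semialgebraic atoms on `C`
  have hx : ∀ i : Fin 3, IsSemialgebraicFunOn ℚ C (fun x => x i) := fun i => isSemialgebraicFunOn_apply hCsa i
  have hca : IsSemialgebraicFunOn ℚ C (fun _ => a) := isSemialgebraicFunOn_const_of_isAlgebraic hCsa ha
  have hc1 : IsSemialgebraicFunOn ℚ C (fun _ => (1:ℝ)) := isSemialgebraicFunOn_const_of_isAlgebraic hCsa isAlgebraic_one
  have hhalf : IsSemialgebraicFunOn ℚ C (fun _ => (1 / 2 : ℝ)) :=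
    hc1.div (isSemialgebraicFunOn_const_ofNat hCsa 2) fun _ _ => two_ne_zero
  -- `k(x i, x 2)`, `k_u(x i, x 2)` (`i = 0, 1`), `κ(x 0, x 2)`
  have hksa : ∀ i : Fin 3, IsSemialgebraicFunOn ℚ C (fun x => -(a * x 2) / (1 - a * x 2 * x i)) := fun i =>
    (hca.fun_mul (hx 2)).fun_neg.div (hc1.fun_sub ((hca.fun_mul (hx 2)).fun_mul (hx i)))
      fun x hx' => (hd2 x hx' 2 i).ne'
  have hkusa : ∀ i : Fin 3, IsSemialgebraicFunOn ℚ C (fun x => -a / (1 - a * x 2 * x i) ^ 2) := fun i =>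
    hca.fun_neg.div ((hc1.fun_sub ((hca.fun_mul (hx 2)).fun_mul (hx i))).fun_pow 2)
      fun x hx' => pow_ne_zero 2 (hd2 x hx' 2 i).ne'
  have hkapsa : IsSemialgebraicFunOn ℚ C (fun x => -(a * x 0) / (1 - a * x 2 * x 0)) :=
    (hca.fun_mul (hx 0)).fun_neg.div (hc1.fun_sub ((hca.fun_mul (hx 2)).fun_mul (hx 0)))
      fun x hx' => (hd2 x hx' 2 0).ne'
  -- continuity of the atoms on `C`
  have hdc : ∀ i : Fin 3, Continuous (fun x : Fin 3 → ℝ => 1 - a * x 2 * x i) := fun i =>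
    continuous_const.sub ((continuous_const.mul (continuous_apply 2)).mul (continuous_apply i))
  have hkc : ∀ i : Fin 3, ContinuousOn (fun x : Fin 3 → ℝ => -(a * x 2) / (1 - a * x 2 * x i)) C := fun i =>
    (continuous_const.mul (continuous_apply 2)).neg.continuousOn.div (hdc i).continuousOn
      fun x hx' => (hd2 x hx' 2 i).ne'
  have hkuc : ∀ i : Fin 3, ContinuousOn (fun x : Fin 3 → ℝ => -a / (1 - a * x 2 * x i) ^ 2) C := fun i =>
    continuousOn_const.div ((hdc i).pow 2).continuousOn fun x hx' => pow_ne_zero 2 (hd2 x hx' 2 i).ne'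
  have hkapc : ContinuousOn (fun x : Fin 3 → ℝ => -(a * x 0) / (1 - a * x 2 * x 0)) C :=
    (continuous_const.mul (continuous_apply 0)).neg.continuousOn.div (hdc 0).continuousOn
      fun x hx' => (hd2 x hx' 2 0).ne'
  -- the witnesses
  obtain ⟨G0, hG0⟩ : ∃ G0 : (Fin 3 → ℝ) → ℝ, ∀ x, G0 x =
      1 / 2 * ((-(a * x 2) / (1 - a * x 2 * x 0)) * (-(a * x 2) / (1 - a * x 2 * x 1))) := ⟨_, fun _ => rfl⟩
  obtain ⟨D0, hD0⟩ : ∃ D0 : (Fin 3 → ℝ) → ℝ, ∀ x, D0 x =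
      1 / 2 * ((-a / (1 - a * x 2 * x 0) ^ 2) * (-(a * x 2) / (1 - a * x 2 * x 1)) +
        (-(a * x 2) / (1 - a * x 2 * x 0)) * (-a / (1 - a * x 2 * x 1) ^ 2)) := ⟨_, fun _ => rfl⟩
  obtain ⟨G1, hG1⟩ : ∃ G1 : (Fin 3 → ℝ) → ℝ, ∀ x, G1 x =
      -((-(a * x 0) / (1 - a * x 2 * x 0)) * (-(a * x 2) / (1 - a * x 2 * x 1))) := ⟨_, fun _ => rfl⟩
  obtain ⟨D1, hD1⟩ : ∃ D1 : (Fin 3 → ℝ) → ℝ, ∀ x, D1 x =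
      -((-a / (1 - a * x 2 * x 0) ^ 2) * (-(a * x 2) / (1 - a * x 2 * x 1))) := ⟨_, fun _ => rfl⟩
  have hG0sa : IsSemialgebraicFunOn ℚ C G0 := (hhalf.fun_mul ((hksa 0).fun_mul (hksa 1))).congr fun x _ => (hG0 x).symm
  have hD0sa : IsSemialgebraicFunOn ℚ C D0 :=
    (hhalf.fun_mul (((hkusa 0).fun_mul (hksa 1)).fun_add ((hksa 0).fun_mul (hkusa 1)))).congr
      fun x _ => (hD0 x).symm
  have hG1sa : IsSemialgebraicFunOn ℚ C G1 := (hkapsa.fun_mul (hksa 1)).fun_neg.congr fun x _ => (hG1 x).symm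
  have hD1sa : IsSemialgebraicFunOn ℚ C D1 := ((hkusa 0).fun_mul (hksa 1)).fun_neg.congr fun x _ => (hD1 x).symm
  have hG0c : ContinuousOn G0 C := (continuousOn_const.mul ((hkc 0).mul (hkc 1))).congr fun x _ => hG0 x
  have hD0c : ContinuousOn D0 C :=
    (continuousOn_const.mul (((hkuc 0).mul (hkc 1)).add ((hkc 0).mul (hkuc 1)))).congr fun x _ => hD0 x
  have hG1c : ContinuousOn G1 C := (hkapc.mul (hkc 1)).neg.congr fun x _ => hG1 x
  have hD1c : ContinuousOn D1 C := ((hkuc 0).mul (hkc 1)).neg.congr fun x _ => hD1 x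
  -- composition with the (semialgebraic, continuous) face maps `x ↦ x[i ↦ t]`, `t ∈ {0, 1}`
  have hface_sa : ∀ {F : (Fin 3 → ℝ) → ℝ}, IsSemialgebraicFunOn ℚ C F → ∀ (i : Fin 3) (t : ℝ), IsAlgebraic ℚ t →
      t ∈ Set.Icc (0:ℝ) 1 → IsSemialgebraicFunOn ℚ C (fun x => F (Function.update x i t)) :=
    fun hF i t ht htI => IsSemialgebraicFunOn.comp_isSemialgebraicMapOn_holds hF
      (isSemialgebraicMapOn_update_const i ht) fun x hx' => hupd x hx' i t htI
  have hface_c : ∀ {F : (Fin 3 → ℝ) → ℝ}, ContinuousOn F C → ∀ (i : Fin 3) (t : ℝ), t ∈ Set.Icc (0:ℝ) 1 →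
      ContinuousOn (fun x => F (Function.update x i t)) C :=
    fun hF i t htI => hF.comp (continuous_id.update i continuous_const).continuousOn fun x hx' => hupd x hx' i t htI
  have hcu : ∀ (x : Fin 3 → ℝ) (i : Fin 3), Continuous fun s : ℝ => Function.update x i s :=
    fun x i => continuous_const.update i continuous_id
  have h0I : (0:ℝ) ∈ Set.Icc (0:ℝ) 1 := ⟨le_rfl, zero_le_one⟩
  have h1I : (1:ℝ) ∈ Set.Icc (0:ℝ) 1 := ⟨zero_le_one, le_rfl⟩
  -- the two integrands and their representations on the cube
  obtain ⟨I0, hI0⟩ : ∃ I0 : (Fin 3 → ℝ) → ℝ, ∀ x, I0 x =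
      D0 x - (G0 (Function.update x 2 1) - G0 (Function.update x 2 0)) := ⟨_, fun _ => rfl⟩
  obtain ⟨I1, hI1⟩ : ∃ I1 : (Fin 3 → ℝ) → ℝ, ∀ x, I1 x =
      D1 x - (G1 (Function.update x 0 1) - G1 (Function.update x 0 0)) := ⟨_, fun _ => rfl⟩
  have hI0sa : IsSemialgebraicFunOn ℚ C I0 :=
    (hD0sa.fun_sub ((hface_sa hG0sa 2 1 isAlgebraic_one h1I).fun_sub (hface_sa hG0sa 2 0 isAlgebraic_zero h0I))).congr
      fun x _ => (hI0 x).symm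
  have hI1sa : IsSemialgebraicFunOn ℚ C I1 :=
    (hD1sa.fun_sub ((hface_sa hG1sa 0 1 isAlgebraic_one h1I).fun_sub (hface_sa hG1sa 0 0 isAlgebraic_zero h0I))).congr
      fun x _ => (hI1 x).symm
  have hI0c : ContinuousOn I0 C :=
    (hD0c.sub ((hface_c hG0c 2 1 h1I).sub (hface_c hG0c 2 0 h0I))).congr fun x _ => hI0 x
  have hI1c : ContinuousOn I1 C :=
    (hD1c.sub ((hface_c hG1c 0 1 h1I).sub (hface_c hG1c 0 0 h0I))).congr fun x _ => hI1 x
  obtain ⟨q0, hq0d, hq0i⟩ := exists_cubeRep 3 I0 hI0sa hI0c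
  obtain ⟨q1, hq1d, hq1i⟩ := exists_cubeRep 3 I1 hI1sa hI1c
  -- bounds
  have hbound : ∀ {F : (Fin 3 → ℝ) → ℝ}, ContinuousOn F C → ∃ B : ℝ, ∀ x ∈ C, |F x| ≤ B := fun hF => by
    obtain ⟨B, hB⟩ := hCc.exists_bound_of_continuousOn hF
    exact ⟨B, fun x hx' => by simpa [Real.norm_eq_abs] using hB x hx'⟩
  -- assemble the two elements
  have hdec : FibStokesDecomposable 3 (fun x => ∑ j, ((![q0, q1] : Fin 2 → IntegralRep 3) j).integrand x) := by
    refine fibStokesDecomposable_of_elements (M := 3) (J := 2) (![2, 0] : Fin 2 → Fin 3)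
      (![G0, G1] : Fin 2 → (Fin 3 → ℝ) → ℝ) (![D0, D1] : Fin 2 → (Fin 3 → ℝ) → ℝ)
      (![q0, q1] : Fin 2 → IntegralRep 3) ?_ ?_
    · refine Fin.forall_fin_two.mpr ⟨?_, ?_⟩
      · -- element 0, along the homotopy direction `2`
        simp only [Matrix.cons_val_zero]
        refine ⟨hG0sa, hD0sa, hbound hG0c, fun x hx' => ?_, fun x hx' hx2 => ?_⟩
        · show ContinuousOn (fun s : ℝ => G0 (Function.update x 2 s)) (Set.Icc (0:ℝ) 1)
          exact hG0c.comp (hcu x 2).continuousOn fun s hs => hupd x hx' 2 s hs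
        · show HasDerivAt (fun s : ℝ => G0 (Function.update x 2 s)) (D0 x) (x 2)
          have hfun : (fun s : ℝ => G0 (Function.update x 2 s)) =
              fun s => 1 / 2 * ((-(a * s) / (1 - a * s * x 0)) * (-(a * s) / (1 - a * s * x 1))) := by
            funext s
            rw [hG0]
            simp only [Function.update_self, Function.update_of_ne h02, Function.update_of_ne h12]
          rw [hfun, hD0]
          exact ((landenThree_hasDerivAt_k a (x 0) (x 2) (hd2 x hx' 2 0).ne').mul
            (landenThree_hasDerivAt_k a (x 1) (x 2) (hd2 x hx' 2 1).ne')).const_mul (1 / 2)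
      · -- element 1, along the cube direction `0`
        simp only [Matrix.cons_val_one, Matrix.cons_val_zero]
        refine ⟨hG1sa, hD1sa, hbound hG1c, fun x hx' => ?_, fun x hx' hx0 => ?_⟩
        · show ContinuousOn (fun s : ℝ => G1 (Function.update x 0 s)) (Set.Icc (0:ℝ) 1)
          exact hG1c.comp (hcu x 0).continuousOn fun s hs => hupd x hx' 0 s hs
        · show HasDerivAt (fun s : ℝ => G1 (Function.update x 0 s)) (D1 x) (x 0)
          have hfun : (fun s : ℝ => G1 (Function.update x 0 s)) =
              fun s => -((-(a * s) / (1 - a * x 2 * s)) * (-(a * x 2) / (1 - a * x 2 * x 1))) := by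
            funext s
            rw [hG1]
            simp only [Function.update_self, Function.update_of_ne h20, Function.update_of_ne h10]
          rw [hfun, hD1]
          exact ((landenThree_hasDerivAt_kappa a (x 2) (x 0) (hd2 x hx' 2 0).ne').mul_const
            (-(a * x 2) / (1 - a * x 2 * x 1))).neg
    · refine Fin.forall_fin_two.mpr ⟨?_, ?_⟩
      · simp only [Matrix.cons_val_zero]
        exact ⟨hq0d, fun x _ => by rw [hq0i, hI0]⟩
      · simp only [Matrix.cons_val_one, Matrix.cons_val_zero]
        exact ⟨hq1d, fun x _ => by rw [hq1i, hI1]⟩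
  -- the pointwise identity on the cube
  refine fibStokesDecomposable_congr_off_null 3 _ _ ∅
    Literature.ModelTheory.ExponentialFields.isSemialgebraic_empty measure_empty (fun x _ _ => ?_) hdec
  simp only [Fin.sum_univ_two, Matrix.cons_val_zero, Matrix.cons_val_one, hq0i, hq1i, hI0, hI1, hG0, hG1, hD0, hD1,
    Function.update_self, Function.update_of_ne h02, Function.update_of_ne h12, Function.update_of_ne h20,
    Function.update_of_ne h10]
  ring

end Summit.KontsevichZagierPeriods.KontsevichZagierPeriods.Cruxes.StokesGeneration.FibrewiseStokes

end
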